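import Mathlib
import Summits.Langlands.Langlands.Theorems.SoloBlindCliffordIndexTwo

/-!
# The archimedean reflection carries no bit: determinant rigidity across an index-two
# subgroup, and involutions of determinant `-1` have trace `0` (solo-Langlands-blind, s9)

Kernel anchor for PROPOSITION 5.12.7 (a),(b) of the dihedral door
(HOME/paper/dihedral-descent.md §5.12.7; paper.md T14 'intrinsic cap').

Setting in the paper: `G = G_K ⊃ H = G_{K̃}` of index two, `ρ : G → GL₂` one of the two extensions
of `ρ̃`, `χ = ε_cyc^{-m}`. (a) If `det ρ = χ` on `H` and at ONE element outside `H` (a reflection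
Frobenius, where the determinant is read off the descended form `Π`), then `det ρ = χ` on all of
`G` — the quotient `det ρ / χ` is a character trivial on `H`, hence constant on `G ∖ H`
(`character_trivial_on_index_two`, E17). (b) If moreover `c ∈ G` is an involution with
`χ(c) = -1` (complex conjugation, `m` odd), then `tr ρ(c) = 0`: by Cayley–Hamilton for `2 × 2`
matrices, `M² = 1` and `det M = -1` force `(tr M)² = 0`. So complex conjugation is a
'reflection-type element without a bit': `ρ(c)` and `-ρ(c) = (ρ ⊗ ε)(c)` have the same trace.

Pure algebra over a commutative ring without zero divisors.
-/

namespace Summit.Langlands.Langlands.Theorems.SoloBlind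

open Matrix

variable {G : Type*} [Group G] {R : Type*} [CommRing R]

/-- **Determinant rigidity across an index-two subgroup.** If the determinant of
`ρ : G → GL_n(R)` agrees with a character `χ` on an index-two subgroup `H` and at one element
outside `H`, it agrees with `χ` everywhere. -/
theorem det_eq_character_of_index_two [NoZeroDivisors R] {n : Type*} [Fintype n] [DecidableEq n]
    (H : Subgroup G) (hidx : H.index = 2) (ρ : G →* Matrix.GeneralLinearGroup n R) (χ : G →* Rˣ)
    (hH : ∀ h ∈ H, Matrix.GeneralLinearGroup.det (ρ h) = χ h) (g₀ : G) (hg₀ : g₀ ∉ H)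
    (h₀ : Matrix.GeneralLinearGroup.det (ρ g₀) = χ g₀) :
    ∀ g, Matrix.GeneralLinearGroup.det (ρ g) = χ g := by
  -- the quotient character `c := (det ∘ ρ) / χ`
  let c : G →* Rˣ := (Matrix.GeneralLinearGroup.det.comp ρ) * χ⁻¹
  have hc_apply : ∀ g, c g = Matrix.GeneralLinearGroup.det (ρ g) * (χ g)⁻¹ := fun g => rfl
  have hcH : ∀ h ∈ H, c h = 1 := by
    intro h hh
    rw [hc_apply, hH h hh, mul_inv_cancel]
  obtain ⟨_, hconst⟩ := character_trivial_on_index_two H hidx c hcH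
  intro g
  by_cases hg : g ∈ H
  · exact hH g hg
  · have h1 : c g = c g₀ := hconst g g₀ hg hg₀
    have h2 : c g₀ = 1 := by rw [hc_apply, h₀, mul_inv_cancel]
    rw [h2, hc_apply, mul_inv_eq_one] at h1
    exact h1

/-- **An involution of determinant `-1` in `GL₂` has trace zero** (Cayley–Hamilton:
`(tr M)² = (M²)₀₀ + (M²)₁₁ + 2 det M = 1 + 1 - 2 = 0`). -/
theorem trace_eq_zero_of_mul_self_eq_one_of_det_eq_neg_one [NoZeroDivisors R]
    (M : Matrix (Fin 2) (Fin 2) R) (hM : M * M = 1) (hdet : M.det = -1) : M.trace = 0 := by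
  have h00 : M 0 0 * M 0 0 + M 0 1 * M 1 0 = 1 := by
    have := congrFun (congrFun hM 0) 0
    simpa [Matrix.mul_apply, Fin.sum_univ_two] using this
  have h11 : M 1 0 * M 0 1 + M 1 1 * M 1 1 = 1 := by
    have := congrFun (congrFun hM 1) 1
    simpa [Matrix.mul_apply, Fin.sum_univ_two] using this
  rw [Matrix.det_fin_two] at hdet
  have hsq : M.trace ^ 2 = 0 := by
    rw [Matrix.trace_fin_two]
    linear_combination h00 + h11 + 2 * hdet
  exact pow_eq_zero_iff (two_ne_zero) |>.mp hsq

/-- **Complex conjugation is a reflection without a bit.** For `ρ : G → GL₂(R)` whose determinant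
is the character `χ` on an index-two subgroup `H` and at one element outside `H`, and an
involution `c ∈ G` with `χ(c) = -1`: `tr ρ(c) = 0`, hence `ρ(c)` and `-ρ(c)` (the value at `c` of
the other extension `ρ ⊗ sgn_H` when `c ∉ H`) have the same trace. -/
theorem trace_conj_eq_zero_of_odd [NoZeroDivisors R] (H : Subgroup G) (hidx : H.index = 2)
    (ρ : G →* Matrix.GeneralLinearGroup (Fin 2) R) (χ : G →* Rˣ)
    (hH : ∀ h ∈ H, Matrix.GeneralLinearGroup.det (ρ h) = χ h) (g₀ : G) (hg₀ : g₀ ∉ H)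
    (h₀ : Matrix.GeneralLinearGroup.det (ρ g₀) = χ g₀)
    (c : G) (hc : c * c = 1) (hχc : (χ c : R) = -1) :
    Matrix.trace (ρ c : Matrix (Fin 2) (Fin 2) R) = 0 ∧
      Matrix.trace (-(ρ c : Matrix (Fin 2) (Fin 2) R)) = 0 := by
  have hdetc : Matrix.GeneralLinearGroup.det (ρ c) = χ c :=
    det_eq_character_of_index_two H hidx ρ χ hH g₀ hg₀ h₀ c
  have hdet : (ρ c : Matrix (Fin 2) (Fin 2) R).det = -1 := by
    have := congrArg Units.val hdetc
    rw [Matrix.GeneralLinearGroup.val_det_apply] at this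
    rw [this, hχc]
  have hM : (ρ c : Matrix (Fin 2) (Fin 2) R) * (ρ c : Matrix (Fin 2) (Fin 2) R) = 1 := by
    rw [← Units.val_mul, ← map_mul, hc, map_one, Units.val_one]
  have htr := trace_eq_zero_of_mul_self_eq_one_of_det_eq_neg_one _ hM hdet
  exact ⟨htr, by rw [Matrix.trace_neg, htr, neg_zero]⟩

end Summit.Langlands.Langlands.Theorems.SoloBlind
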